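import Literature.AlgebraicGeometry.Modules.BoundedCohRepresentative
import Literature.AlgebraicGeometry.Morphisms.CechCocycleCoherentSubmodule
import Literature.AlgebraicGeometry.Morphisms.CohAffineExactness
import Literature.AlgebraicGeometry.Modules.IsoOfAffineCover
import HarnessLib

/-!
# SGA 6 II Cor. 2.2.2.1 on a noetherian separated scheme: every object of `D⁺(Mod 𝒪_X)` with bounded coherent
# cohomology is the class of a bounded complex of COHERENT modules (`D^b(Coh X) → D^b_coh(Mod 𝒪_X)` essentially surjective)

Layer `Literature/AlgebraicGeometry/Modules`. `Modules/BoundedCohRepresentative` proves the statement for objects with a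
quasi-coherent representative GRANTED the lifting property `hlift` («every epimorphism from a quasi-coherent module onto a
coherent module is dominated by a coherent module»), and discharges `hlift` on projective `k`-schemes by Serre's theorem.
Here `hlift` is discharged on EVERY noetherian separated scheme, from EGA I (1971) 6.9.9 ∕ Hartshorne II Ex. 5.15 (e) in
its tree form `Morphisms/CechCocycleCoherentSubmodule.exists_coh_mono_app_eq` (finitely many local sections of an
affine-localizing module lie in ONE coherent submodule):

* §1 **`exists_coh_mono_epi_comp_of_epi`** ∕ **`exists_coh_epi_comp_of_epi`** — for `g : M ↠ N` an epimorphism from an affine-localizing module onto a coherent module on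
  a noetherian separated scheme there is a COHERENT `M′` with `ι : M′ ⟶ M` (a monomorphism) and `ι ≫ g` an epimorphism: cover
  `X` by finitely many affine opens `U_k`; `Γ(N, U_k)` is finitely generated (`IsAffineFiniteType`), its generators lift to
  `Γ(M, U_k)` (`Morphisms/CohAffineExactness.app_surjective_of_epi`), the lifts lie in one coherent `M′ ↪ M`
  (`exists_coh_mono_app_eq`), and `ι ≫ g` is onto over every `U_k` (§1), hence an epimorphism
  (`Modules/IsoOfAffineCover.epi_of_app_surjective_of_cover`);
* §2 **`exists_boundedCohComplex_of_boundedCoh`** — on a noetherian separated scheme `X`, every `E ∈ D⁺(Mod 𝒪_X)` with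
  `E.IsGE a`, `E.IsLE b` and coherent cohomology sheaves is `Q⁺⟨K, m, _⟩` for a complex `K` of COHERENT modules concentrated
  in degrees `[m, b]`: Stage I (`Modules/QcRepresentativeOfSeparated.exists_qcRepresentative_of_compactSpace`) and
  `Modules/BoundedCohRepresentative.exists_cohModel_of_qcRepresentative_of_isLE` with `hlift` from §1. No regularity, no
  projectivity.

Everything is PROVED; 0 named facts, no definitions, no instances. Typed for the cell `pub-hodge-ring2` (library; a research
route conditional on HC_CM, not a corollary — nothing in this file refers to it).

## References

* P. Berthelot, A. Grothendieck, L. Illusie, *SGA 6*, Exp. II, Cor. 2.2.2.1. [SGA6]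
* D. Huybrechts, *Fourier–Mukai transforms in algebraic geometry* (2006), Prop. 3.26. [HuybrechtsFM2006]
* The Stacks Project, Tags 0FDA, 08E8 (`D^b(Coh 𝒪_X) → D^b_Coh(QCoh 𝒪_X)` for `X` noetherian), 01PG, 01Y8. [StacksProject]
* A. Grothendieck, J. Dieudonné, *EGA I* (Springer 1971), 6.9.9; *EGA I* (1960), Cor. 9.4.9. [EGAInew]
* R. Hartshorne, *Algebraic Geometry*, GTM 52 (1977), II Prop. 5.6, II Ex. 5.15 (e) (p. 126). [Hartshorne1977]
-/

noncomputable section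

-- `TopCat.Presheaf`/`Scheme.Modules` are not reducible (as in Mathlib's `AlgebraicGeometry/Modules/Sheaf.lean`).
set_option backward.isDefEq.respectTransparency false

universe w u

open CategoryTheory CategoryTheory.Limits AlgebraicGeometry TopologicalSpace Opposite

namespace Literature.AlgebraicGeometry.Modules

open Literature.AlgebraicGeometry.Morphisms

/-! ## §1 The lifting property on a noetherian separated scheme (EGA I 6.9.9 ∕ 9.4.9) -/

section Lift

/-- A linear map whose range contains a set spanning the target is surjective. [folklore] -/
private theorem surjective_of_span_le_range {R : Type*} [CommSemiring R] {P Q : Type*} [AddCommMonoid P] [Module R P]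
    [AddCommMonoid Q] [Module R Q] (f : P →ₗ[R] Q) (s : Set Q) (hs : Submodule.span R s = ⊤)
    (hf : s ⊆ LinearMap.range f) : Function.Surjective f := by
  rw [← LinearMap.range_eq_top, eq_top_iff, ← hs]
  exact Submodule.span_le.mpr hf

variable {X : Scheme.{u}} [IsNoetherian X] [X.IsSeparated]

/-- **The lifting property of a noetherian separated scheme** (EGA I (1971) 6.9.9 ∕ EGA I 9.4.9 ∕ Hartshorne II Ex. 5.15 (e),
finite form): an epimorphism `g : M ↠ N` from an affine-localizing (quasi-coherent) module onto a COHERENT module is dominated by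
a coherent submodule — there are a coherent `M′`, a monomorphism `ι : M′ ⟶ M`, and `ι ≫ g` is an epimorphism. Proof: on a finite
affine cover `U_k` the finitely many generators of `Γ(N, U_k)` lift to `Γ(M, U_k)` (`app_surjective_of_epi`); the lifts lie in one
coherent `M′ ↪ M` (`exists_coh_mono_app_eq`); `ι ≫ g` is onto over each `U_k`, hence epi (`epi_of_app_surjective_of_cover`).
[cite: Hartshorne1977, II Ex. 5.15 (e) (p. 126) and II Prop. 5.6 (p. 113)] [cite: StacksProject, Tag 01PG and Tag 01Y8] -/
theorem exists_coh_mono_epi_comp_of_epi {M N : X.Modules} (g : M ⟶ N) [Epi g] (hM : IsAffineLocalizing M) (hN : Coh N) :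
    ∃ (M' : X.Modules) (ι : M' ⟶ M), Coh M' ∧ Mono ι ∧ Epi (ι ≫ g) := by
  classical
  -- a finite affine cover
  obtain ⟨m, U, hU, hcov⟩ := exists_fin_affine_cover (X := X)
  -- finite generating sets of the sections of `N` over the `U k`
  have hfg : ∀ k, (⊤ : Submodule Γ(X, U k) Γ(N, U k)).FG := fun k =>
    (Module.finite_def.mp (hN.ft (hU k)))
  choose S hS using hfg
  -- lifts of the generators to sections of `M`
  have hlift : ∀ k (n : Γ(N, U k)), ∃ s : Γ(M, U k), g.app (U k) s = n :=
    fun k n => app_surjective_of_epi g hM hN.loc (hU k) n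
  choose s hs using hlift
  -- index the generators: `κ = Σ k, S k`
  let κ := Σ k : Fin m, ((S k : Finset Γ(N, U k)) : Set Γ(N, U k))
  haveI : Finite κ := by
    haveI : ∀ k : Fin m, Finite ((S k : Finset Γ(N, U k)) : Set Γ(N, U k)) := fun k =>
      Finite.of_fintype _
    exact Finite.instSigma
  obtain ⟨M', ι, hM', hι, hy⟩ :=
    exists_coh_mono_app_eq hM (κ := κ) (fun i => U i.1) (fun i => s i.1 i.2.1)
  refine ⟨M', ι, hM', hι, epi_of_app_surjective_of_cover (ι ≫ g) hN.loc U hU hcov fun k => ?_⟩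
  -- `Γ(M′, U k) → Γ(N, U k)` is onto: its range contains the generators
  refine surjective_of_span_le_range (appLinear (ι ≫ g) (U k)) (S k : Set Γ(N, U k)) (hS k) fun n hn => ?_
  obtain ⟨y, hy'⟩ := hy ⟨k, ⟨n, hn⟩⟩
  refine ⟨y, ?_⟩
  rw [appLinear_apply, Scheme.Modules.Hom.comp_app]
  change g.app (U k) (ι.app (U k) y) = n
  rw [hy', hs]

/-- The lifting hypothesis `hlift` of `Modules/BoundedCohRepresentative.exists_cohModel_of_qcRepresentative` HOLDS on a noetherian
separated scheme. [cite: Hartshorne1977, II Ex. 5.15 (e) (p. 126)] [cite: StacksProject, Tag 01PG] -/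
theorem exists_coh_epi_comp_of_epi {M N : X.Modules} (g : M ⟶ N) [Epi g] (hM : IsAffineLocalizing M) (hN : Coh N) :
    ∃ (F : X.Modules) (p : F ⟶ M), Coh F ∧ Epi (p ≫ g) := by
  obtain ⟨M', ι, hM', -, hepi⟩ := exists_coh_mono_epi_comp_of_epi g hM hN
  exact ⟨M', ι, hM', hepi⟩

end Lift

/-! ## §2 SGA 6 II Cor. 2.2.2.1 on a noetherian separated scheme -/

section Representative

variable {X : Scheme.{u}} [IsNoetherian X] [X.IsSeparated]

/-- **SGA 6 II Cor. 2.2.2.1 (essential surjectivity of `D^b(Coh X) → D^b_coh(Mod 𝒪_X)`) on a noetherian separated scheme**: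
every `E ∈ D⁺(Mod 𝒪_X)` with `E.IsGE a`, `E.IsLE b` and coherent cohomology sheaves is the class `Q⁺⟨K, m, _⟩` of a complex `K` of
COHERENT `𝒪_X`-modules concentrated in degrees `[m, b]` — no regularity, no projectivity. Stage I
(`exists_qcRepresentative_of_compactSpace`: a bounded-below quasi-coherent representative, `X` being quasi-compact and separated),
then `exists_cohModel_of_qcRepresentative_of_isLE` with the lifting property `exists_coh_epi_comp_of_epi` (§1).
[cite: SGA6, Exp. II Cor. 2.2.2.1] [cite: HuybrechtsFM2006, Prop. 3.26] [cite: StacksProject, Tag 0FDA and Tag 08E8] -/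
theorem exists_boundedCohComplex_of_boundedCoh [HasDerivedCategory.{w} X.Modules] (E : DerivedCategory.Plus X.Modules)
    (a b : ℤ) (hE : E.IsGE a) (hb : E.IsLE b)
    (hcoh : ∀ i : ℤ, Coh ((DerivedCategory.Plus.homologyFunctor _ i).obj E)) :
    ∃ (K : CochainComplex X.Modules ℤ) (m : ℤ) (hm : K.IsStrictlyGE m),
      K.IsStrictlyLE b ∧ (∀ i, Coh (K.X i)) ∧ Nonempty (DerivedCategory.Plus.Q.obj ⟨K, m, hm⟩ ≅ E) := by
  haveI := hE
  obtain ⟨M, hn, -, hM, ⟨eM⟩⟩ := exists_qcRepresentative_of_compactSpace E a (fun i => (hcoh i).loc)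
  exact exists_cohModel_of_qcRepresentative_of_isLE (fun g _ hF hG => exists_coh_epi_comp_of_epi g hF hG)
    E b hb hcoh M hn hM eM

end Representative

end Literature.AlgebraicGeometry.Modules

end
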